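import Mathlib

/-!
# Door D7, the local prefix law: the one-pair case of mixed closure (Theorem A)

Context (`SoloInformedCwTwoValueWeights`, `SoloInformedCwTwoPairingDesigns`): a monomial degeneration of
`T_{cw,2}^{⊠N}` into the truncated polynomial algebra `ℂ[x]/(x^{σ+1})` is an *integer weighted design* with digit
pairs `(s_k, d_k)` and cost `σ = ∑ (s_k + d_k)`; conjecturally `σ ≥ 4^N - 1` (D7-closure).  The conjecture is
*local*: the `j` smallest digits of a design, with their induced pair structure (`p` complete pairs, `q` digits
whose partner is large — "singletons"), form a *mixed design*, and MIXED CLOSURE asserts that their sum is at least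
`2^(2p+q) - 1`.  For `p = 0` this is the classical fact that `q` dissociated positive integers have sum
`≥ 2^q - 1`.  This file proves the case `p = 1` for every `q`:

**Theorem A.** Let `t : Fin q → ℕ` have distinct subset sums, and let `s < d` be such that no two subset sums of
`t` differ by `s`, by `d` or by `d - s` (the *hexagon* conditions: each such coincidence is an opposite pair of
allowed relations) and such that there is no *constant-column certificate*
`∑B = s + d + ∑A₁ ∧ 2s + ∑A₁ = d + ∑A₂` (the three relations `((-1,-1),1_B-1_{A₁})`, `((2,-1),1_{A₁}-1_{A₂})`,
`((-1,2),1_{A₂}-1_B)` are allowed and sum to zero, so such a system is balanced, i.e. not a design).  Then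
`s + d + ∑ t ≥ 4·2^q - 1`.

These four hypotheses are exactly the consequences of the mixed-design property that the proof uses.  Proof: the
map `Ψ : Fin 4 × Finset (Fin q) → [0, σ]`, `Ψ(0,A) = ∑A`, `Ψ(1,A) = s + ∑A`, `Ψ(2,A) = d + ∑A`,
`Ψ(3,A) = s + d + ∑A` unless that value is a subset sum, in which case the *rescue value* `2s + ∑A` is used,
is injective.

Written by the solo-informed seat (gen 10); standard axioms only.
-/

namespace Summit.MatrixMultiplication.MatrixMultiplication.Theorems

open Finset

/-- Subset sum of `t` over `A`. -/
def subsetSum {q : ℕ} (t : Fin q → ℕ) (A : Finset (Fin q)) : ℕ := ∑ i ∈ A, t i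

/-- A subset sum is at most the total sum. -/
theorem subsetSum_le_total {q : ℕ} (t : Fin q → ℕ) (A : Finset (Fin q)) :
    subsetSum t A ≤ ∑ i, t i := by
  unfold subsetSum
  exact Finset.sum_le_sum_of_subset_of_nonneg (Finset.subset_univ A) (fun _ _ _ => Nat.zero_le _)

open Classical in
/-- The rescue-or-binary value attached to the complete pair: `s + d + ∑A`, or `2s + ∑A` when the former
collides with a subset sum. -/
noncomputable def pairValue {q : ℕ} (t : Fin q → ℕ) (s d : ℕ) (A : Finset (Fin q)) : ℕ :=
  if ∃ B : Finset (Fin q), subsetSum t B = s + d + subsetSum t A then 2 * s + subsetSum t A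
  else s + d + subsetSum t A

/-- The certifying map `Ψ` of Theorem A. -/
noncomputable def psi {q : ℕ} (t : Fin q → ℕ) (s d : ℕ) : Fin 4 × Finset (Fin q) → ℕ :=
  fun x => (![subsetSum t x.2, s + subsetSum t x.2, d + subsetSum t x.2, pairValue t s d x.2] : Fin 4 → ℕ) x.1

/-- Every value of `Ψ` lies in `[0, s + d + ∑ t]` (uses `s < d` for the rescue value `2s + ∑A`). -/
theorem psi_le {q : ℕ} (t : Fin q → ℕ) (s d : ℕ) (hsd : s < d) (x : Fin 4 × Finset (Fin q)) :
    psi t s d x ≤ s + d + ∑ i, t i := by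
  obtain ⟨i, A⟩ := x
  have hA := subsetSum_le_total t A
  unfold psi
  fin_cases i
  · simp; omega
  · simp; omega
  · simp; omega
  · simp only
    show pairValue t s d A ≤ _
    unfold pairValue
    split_ifs <;> omega

/-- **Theorem A** (one-pair mixed closure, all `q`). -/
theorem onePair_mixed_closure {q : ℕ} (t : Fin q → ℕ) (s d : ℕ) (hsd : s < d)
    (hdiss : ∀ A B : Finset (Fin q), subsetSum t A = subsetSum t B → A = B)
    (hs : ∀ A B : Finset (Fin q), subsetSum t B ≠ s + subsetSum t A)
    (hd : ∀ A B : Finset (Fin q), subsetSum t B ≠ d + subsetSum t A)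
    (hds : ∀ A B : Finset (Fin q), s + subsetSum t B ≠ d + subsetSum t A)
    (hconst : ∀ A₁ A₂ B : Finset (Fin q),
      subsetSum t B = s + d + subsetSum t A₁ → 2 * s + subsetSum t A₁ ≠ d + subsetSum t A₂) :
    4 * 2 ^ q ≤ s + d + ∑ i, t i + 1 := by
  classical
  -- injectivity of Ψ
  have key : ∀ (A B : Finset (Fin q)), pairValue t s d A = pairValue t s d B → A = B := by
    intro A B h
    unfold pairValue at h
    split_ifs at h with h1 h2 h2
    · exact hdiss A B (by omega)
    · exact absurd (by omega : s + subsetSum t A = d + subsetSum t B) (hds B A)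
    · exact absurd (by omega : s + subsetSum t B = d + subsetSum t A) (hds A B)
    · exact hdiss A B (by omega)
  have k0 : ∀ (A B : Finset (Fin q)), subsetSum t A = pairValue t s d B → False := by
    intro A B h
    unfold pairValue at h
    split_ifs at h with h1
    · obtain ⟨B₀, hB₀⟩ := h1
      exact hds A B₀ (by omega)
    · exact h1 ⟨A, h⟩
  have k1 : ∀ (A B : Finset (Fin q)), s + subsetSum t A = pairValue t s d B → False := by
    intro A B h
    unfold pairValue at h
    split_ifs at h with h1
    · exact hs B A (by omega)
    · exact hd B A (by omega)
  have k2 : ∀ (A B : Finset (Fin q)), d + subsetSum t A = pairValue t s d B → False := by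
    intro A B h
    unfold pairValue at h
    split_ifs at h with h1
    · obtain ⟨B₀, hB₀⟩ := h1
      exact hconst B A B₀ hB₀ (by omega)
    · exact hs B A (by omega)
  have hinj : Function.Injective (psi t s d) := by
    rintro ⟨i, A⟩ ⟨j, B⟩ h
    unfold psi at h
    fin_cases i <;> fin_cases j <;> simp at h
    all_goals first
      | exact (hs A B (by omega)).elim
      | exact (hs B A (by omega)).elim
      | exact (hd A B (by omega)).elim
      | exact (hd B A (by omega)).elim
      | exact (hds A B (by omega)).elim
      | exact (hds B A (by omega)).elim
      | exact (k0 A B (by omega)).elim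
      | exact (k0 B A (by omega)).elim
      | exact (k1 A B (by omega)).elim
      | exact (k1 B A (by omega)).elim
      | exact (k2 A B (by omega)).elim
      | exact (k2 B A (by omega)).elim
      | (cases hdiss A B (by omega); rfl)
      | (cases key A B (by omega); rfl)
  -- counting
  have hsub : (univ : Finset (Fin 4 × Finset (Fin q))).image (psi t s d) ⊆ range (s + d + ∑ i, t i + 1) := by
    intro v hv
    rw [mem_image] at hv
    obtain ⟨x, -, rfl⟩ := hv
    rw [mem_range]
    have := psi_le t s d hsd x
    omega
  have hcard := card_le_card hsub
  rw [card_image_of_injective _ hinj, card_univ, Fintype.card_prod, Fintype.card_fin, Fintype.card_finset,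
    Fintype.card_fin, card_range] at hcard
  exact hcard

end Summit.MatrixMultiplication.MatrixMultiplication.Theorems
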